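import Literature.MathematicalPhysics.QuantumFieldTheory.Balaban1983to89.B6Ineq268MultiLevelTorus

/-!
# `Balaban1983to89.B9Thm314GpFlatTorusGeometry` — [B9] Theorem 3.14 / (3.154) AT `U = 1` on the genuine `k`-level
torus, FILE 1: TWO nested families `{Ω_j}`, `{Ω′_j}` on ONE torus `T_η`, the region `Ω = Ω_k ∩ Ω′_k`, the distance
`d(y, y′, Ω)` of (3.154) on the `L^kη`-lattice, the bond-length comparison `|y − y′| ≤ L^k·d(y, y′)`, and the
perturbation `Δ′_a[Ω′] − Δ′_a[Ω]` with the resolvent identity `G′[Ω] − G′[Ω′] = G′[Ω](Δ′_a[Ω′] − Δ′_a[Ω])G′[Ω′]`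
(no existing module is touched; no fact is minted)

FRAMING (verbatim cell line):
statement-level skeleton of published theorems with citation tags; proofs where landed; nothing here is a claim about the Yang–Mills mass gap

Sources under audit (cell pub-balaban / lit-balaban): T. Bałaban, *Propagators for lattice gauge theories in a
background field*, Commun. Math. Phys. **99** (1985) 389–434 [`Balaban1985BackgroundPropagators`, "B9"], pp. 426–427
[PDF 38–39] (Theorem 3.14, (3.154); held text `paper:balaban1985-cmp99-background-propagators` p0038/p0039, read this
generation); T. Bałaban, *Propagators and renormalization transformations for lattice gauge theories. II*, Commun. Math.
Phys. **96** (1984) 223–250 [`Balaban1984PropagatorsII`, "[4]" of B9, "B6"], p. 224 (2.1)–(2.4), p. 225 (2.13)–(2.14),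
p. 229 («Boundary conditions of this type can be interpreted as obtained by building an effective mass …»).  Unit
`lit-balaban-p21` (Phase-2 proof seat p21 gen 18, HOME `run/shared/lean/pub/lit-balaban/`, free-target protocol
G.5-34(d); B9 fold owner r06, B6 fold owner r03, referee ref-4).  Setting = the torus lineage of this seat
(`B6MultiLevelTorusOperator` T1, `B6Geom246MultiLevelTorus` T3, `B8Ineq192MultiLevelTorus`/`B6Ineq268MultiLevelTorus`).

## WHAT IS PRINTED (B9 pp. 426–427, verbatim up to notation)

«Let us assume that we have two sequences of domains {Ω_j}, {Ω′_j}, both satisfying the conditions (2.1)-(2.4) in [4],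
with M and R sufficiently large, so that all the conditions needed in this paper are satisfied. We construct operators
for both sequences and we define Ω = Ω_k ∩ Ω′_k. Let us take localizations determined by points y, y′ ∈ Ω^{(k)} (i.e.
these are cubes Δ̃(y), Δ̃(y′) in the case of operators G′, G, G₁, 𝔊, …). We have  **Theorem 3.14.** If we take a pair of
operators constructed for the two sequences {Ω_j}, {Ω′_j}, then their difference satisfies all the inequalities
characteristic for operators of the considered type, with the additional factor exp(−δ₀d(y, y′, Ω)),
d(y, y′, Ω) = inf_{y₁∈Ωᶜ∩T^{(k)}} (|y − y₁| + |y₁ − y′|) (3.154) on the right-hand sides.  This theorem can be proved in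
exactly the same way as the corresponding property in the theorem of [2]. We take random walk expansions for both
operators, and in the difference all terms for walks with localizations contained in Ω are cancelled. Remaining terms
correspond to walks of the general type (3.107), for which at least one localization X_i intersects Ωᶜ. Then the
exponential factor in (3.108) gives the factor (3.154) (after adjusting a definition of δ₀).»

## WHAT THIS FILE CERTIFIES (kernel-checked; lattice units `η = 1` of the lineage)

Two nested families `D, D′ : TDomains d ℓ M_h k P R` of the SAME torus (fundamental box `Π_μ[0, N₀_μ)`,
`N₀_μ = L^k·L·M_h·P_μ`, levels `1 … k`, `Ω₁ = Ω′₁ = T_η`).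
* §1 the centre of the `b`-block of a lattice point (`cenLab`, `cenB`; `dist_toR_cenB_le`: a point is within `(b − 1)/2`
  of the centre of its block; `cen_eq_cenLab`: the block centres of the lineage are these centres).
* §2 **`|y − y′|_T ≤ L^k·d_T(y, y′)`** (`dist_posT_le_mul_distT`): the positions of two blocks of `𝔅` on the real torus
  are at most `L^k` times the multiscale distance (2.46) apart — every admissible bond has torus length `≤ L^k`
  (`B6Geom246MultiLevelTorus.dist_posT_le_of_adj`).
* §3 **`Ω = Ω_k ∩ Ω′_k`** as the set of torus sites at level `k` in both families (`OmegaSite`), the `L^k`-lattice points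
  outside `Ω` (`OmegaC`: labels of `k`-blocks containing a site outside `Ω`; by (2.1) = the `k`-blocks outside `Ω`,
  `mem_OmegaC_iff_of_blk_eq`), the distance of two `k`-lattice points `|y − y₁|` = torus sup-distance of the block centres in
  units of `L^k` (`tdistK`), and **(3.154) `dOmega D D′ y y′ = inf_{y₁ ∈ Ωᶜ ∩ T^{(k)}}(|y − y₁| + |y₁ − y′|)`** (value `0`
  when `Ωᶜ = ∅`, where the two operators coincide, `B9Thm314GpFlatMultiLevelTorus.gmlT_eq_of_lev_eq`); the located
  inequality **`dOmega_le_of_witness`**: for a top block `y` of `D`, a `D`-block `b` containing a site `z` with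
  `lev_D z ≠ lev_{D′} z` and a site `w`, and a top block `y′` of `D′`:
  `d(y, y′, Ω) ≤ d_D(y, b) + d_{D′}(y^{D′}(w), y′) + 3` — the metric step behind «the exponential factor in (3.108) gives
  the factor (3.154)».
* §4 **THE PERTURBATION** `diffM D D′ a = Δ′_a[D′] − Δ′_a[D]` (`mlOpT` of T1 for the two level functions): its entries
  (`diffM_apply`: the periodic Laplacians cancel, only the averaging terms `a_jL^{−2j}Q′_j*1_{Λ_j}Q′_j` of (2.14) remain),
  **its rows vanish where the two level functions agree** (`diffM_apply_of_lev_eq` — print's «all terms for walks with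
  localizations contained in Ω are cancelled»), the row bound `|(diffM·v)(z)| ≤ a₊L^{−2lev′z}·max_{B′(z)}|v| +
  a₊L^{−2lev z}·max_{B(z)}|v|` in the form consumed by file 2 (`abs_diffM_mulVec_le`), and **THE RESOLVENT IDENTITY**
  `G′[D] − G′[D′] = G′[D]·(Δ′_a[D′] − Δ′_a[D])·G′[D′]` (`gmlT_sub_gmlT`).

## HONEST SCOPE

* `U = 1` (no background gauge field: B9's theorem is stated for regular `U`; this lineage is its flat instance, the
  operators being [4]'s `Δ′_a`, `G′` of (2.13)–(2.14) on `T_η` with `Ω₁ = T_η`, levels `1 … k`, `A = 0`, `m² = 0`,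
  lattice units, as in the whole torus lineage T1–T6/G0–G4 of this seat).
* (3.154): `T^{(k)}` = the `L^kη`-lattice of the torus read as the set of `k`-blocks (labels), `|y − y₁|` = the
  sup-distance of the real torus `Π_μ ℝ/N₀_μℤ` between block centres in units of `L^k` (print fixes no norm); `Ωᶜ` read
  on `k`-blocks («Ω_k^{(k)} … is a sum of big blocks», (2.1)).  The infimum over the empty set is replaced by `0` (then
  `D.lev = D′.lev` everywhere and the difference of the operators vanishes identically, file 2).
* This file proves no inequality of Theorem 3.14; it sets up the two-family geometry and algebra for file 2
  (`B9Thm314GpFlatMultiLevelTorus`).  Nothing is inferred from the manuscript: every step is kernel-checked; the quoted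
  sentences locate the statements.
-/

namespace Literature.MathematicalPhysics.QuantumFieldTheory.Balaban1983to89.B9Thm314GpFlatTorusGeometry

open Finset Matrix
open Literature.MathematicalPhysics.QuantumFieldTheory.Balaban1983to89.B4Reflection242 (boxDom mem_boxDom blk avgK)
open Literature.MathematicalPhysics.QuantumFieldTheory.Balaban1983to89.B4TorusKernel.MultiPeriod (torusSupNorm)
open Literature.MathematicalPhysics.QuantumFieldTheory.Balaban1983to89.B6MultiLevelBoxOperator
open Literature.MathematicalPhysics.QuantumFieldTheory.Balaban1983to89.B6MultiLevelTorusOperator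
open Literature.MathematicalPhysics.QuantumFieldTheory.Balaban1983to89.B6Geom246MultiLevelBox
open Literature.MathematicalPhysics.QuantumFieldTheory.Balaban1983to89.B6Geom246MultiLevelTorus
open Literature.MathematicalPhysics.QuantumFieldTheory.Balaban1983to89.B6Ineq268MultiLevelBox (W W_pos W_eq
  card_blkOf_le)
open Literature.MathematicalPhysics.QuantumFieldTheory.Balaban1983to89.B8Ineq192MultiLevelTorus (lenT_eq symmT)

noncomputable section

variable {d : ℕ}

/-! ## §1 Block centres of lattice points -/

section Centres

/-- the centre of the `b`-block with label `β`: `b·β + (b − 1)/2`. [cite: Balaban1984PropagatorsII, (2.1) p.224 («blocks … L^jη»), dictionary] -/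
def cenLab (b : ℕ) (β : Fin (d + 1) → ℤ) : Fin (d + 1) → ℝ := fun μ => (b : ℝ) * (β μ : ℝ) + ((b : ℝ) - 1) / 2

/-- the centre of the `b`-block of the lattice point `x`. [cite: Balaban1984PropagatorsII, (2.1) p.224, dictionary] -/
def cenB (b : ℕ) (x : Fin (d + 1) → ℤ) : Fin (d + 1) → ℝ := cenLab b (blk b x)

/-- a lattice point is within `(b − 1)/2` of the centre of its `b`-block (sup metric). [cite: Balaban1984PropagatorsII, (2.1) p.224, dictionary] -/
theorem dist_toR_cenB_le {b : ℕ} (hb : 1 ≤ b) (x : Fin (d + 1) → ℤ) : dist (toR x) (cenB b x) ≤ ((b : ℝ) - 1) / 2 := by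
  have hb0 : (0 : ℤ) < b := by exact_mod_cast hb
  have hb1 : (1 : ℝ) ≤ b := by exact_mod_cast hb
  refine (dist_pi_le_iff (by linarith)).2 fun μ => ?_
  have hdiv : x μ % (b : ℤ) + x μ / (b : ℤ) * (b : ℤ) = x μ := Int.emod_add_ediv_mul _ _
  have hr0 : 0 ≤ x μ % (b : ℤ) := Int.emod_nonneg _ hb0.ne'
  have hr1 : x μ % (b : ℤ) < b := Int.emod_lt_of_pos _ hb0
  have hr1' : x μ % (b : ℤ) ≤ b - 1 := by omega
  have e0 : x μ = (b : ℤ) * (x μ / (b : ℤ)) + x μ % (b : ℤ) := by linarith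
  have e : ((x μ : ℤ) : ℝ) = (b : ℝ) * (((x μ / (b : ℤ)) : ℤ) : ℝ) + (((x μ % (b : ℤ)) : ℤ) : ℝ) := by
    exact_mod_cast e0
  have hr0' : (0 : ℝ) ≤ ((x μ % (b : ℤ) : ℤ) : ℝ) := by exact_mod_cast hr0
  have hr1'' : ((x μ % (b : ℤ) : ℤ) : ℝ) ≤ (b : ℝ) - 1 := by exact_mod_cast hr1'
  rw [Real.dist_eq]
  show |((x μ : ℤ) : ℝ) - ((b : ℝ) * (((x μ / (b : ℤ)) : ℤ) : ℝ) + ((b : ℝ) - 1) / 2)| ≤ _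
  rw [e, abs_le]
  constructor <;> linarith

/-- the block centres of the box lineage ARE these centres: `cen (j, β) = cenLab (L^j) β`. [cite: Balaban1984PropagatorsII, (2.1) p.224, dictionary] -/
theorem cen_eq_cenLab {ℓ Mh k R : ℕ} {P : Fin (d + 1) → ℕ} (D : Domains d ℓ Mh k P R) (s : ↥(bset D)) :
    cen D s = cenLab ((ℓ + 1) ^ s.1.1) s.1.2 := by
  funext μ; simp only [cen, cenLab, Nat.cast_pow, Nat.cast_add, Nat.cast_one]

/-- … and for a site of the block, the centre of its `L^j`-block. [cite: Balaban1984PropagatorsII, (2.1) p.224, dictionary] -/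
theorem cen_eq_cenB {ℓ Mh k R : ℕ} {P : Fin (d + 1) → ℕ} (D : Domains d ℓ Mh k P R) {x : ↥(boxDom (N0 ℓ Mh k P))}
    {s : ↥(bset D)} (h : blkOf D x = s) : cen D s = cenB ((ℓ + 1) ^ s.1.1) x.1 := by
  rw [cen_eq_cenLab, cenB, (blkOf_eq_iff_blk D).1 h]

end Centres

/-! ## §2 `|y − y′|_T ≤ L^k·d_T(y, y′)`: torus positions against the multiscale distance (2.46) -/

section BondLength

variable {ℓ Mh k R : ℕ} {P : Fin (d + 1) → ℕ} (D : TDomains d ℓ Mh k P R)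

/-- powers of `L` are monotone (real form). [cite: Balaban1984PropagatorsII, (2.1) p.224, dictionary] -/
theorem powL_mono_real {a b : ℕ} (h : a ≤ b) : (((ℓ + 1) ^ a : ℕ) : ℝ) ≤ (((ℓ + 1) ^ b : ℕ) : ℝ) := by
  exact_mod_cast Nat.pow_le_pow_right (by omega) h

/-- **along an admissible contour of the torus the position moves by at most `L^k` per bond** (every block of `𝔅` has
level `≤ k`). [cite: Balaban1984PropagatorsII, (2.46) p.231 («bonds of the lattice Λ_j»), (2.3)–(2.4) p.224] -/
theorem dist_posT_le_length :
    ∀ {a b : ↥(bset D.toDomains)} (p : (bondT D).Walk a b),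
      dist (posT D a) (posT D b) ≤ (p.length : ℝ) * (((ℓ + 1) ^ k : ℕ) : ℝ) := by
  intro a b p
  induction p with
  | nil => simp
  | @cons a c b h p ih =>
    have hstep : dist (posT D a) (posT D c) ≤ (((ℓ + 1) ^ k : ℕ) : ℝ) :=
      (dist_posT_le_of_adj h).trans
        (powL_mono_real (max_le (scale_bounds D.toDomains a).2 (scale_bounds D.toDomains c).2))
    rw [SimpleGraph.Walk.length_cons, Nat.cast_add, Nat.cast_one, add_mul, one_mul]
    calc dist (posT D a) (posT D b) ≤ dist (posT D a) (posT D c) + dist (posT D c) (posT D b) := dist_triangle _ _ _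
      _ ≤ (((ℓ + 1) ^ k : ℕ) : ℝ) + (p.length : ℝ) * (((ℓ + 1) ^ k : ℕ) : ℝ) := add_le_add hstep ih
      _ = (p.length : ℝ) * (((ℓ + 1) ^ k : ℕ) : ℝ) + (((ℓ + 1) ^ k : ℕ) : ℝ) := by ring

/-- **`|y − y′|_T ≤ L^k·d_T(y, y′)`**: the torus distance of the positions of two blocks of `𝔅` is at most `L^k` times their
multiscale distance (2.46) (a shortest admissible contour exists, `connectedT`). [cite: Balaban1984PropagatorsII, (2.46) p.231; Balaban1985BackgroundPropagators, (3.154) p.427 («|y − y₁| + |y₁ − y′|»)] -/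
theorem dist_posT_le_mul_distT (hMh : 1 ≤ Mh) (hP : ∀ μ, 1 ≤ P μ) (a b : ↥(bset D.toDomains)) :
    dist (posT D a) (posT D b) ≤ (geomT D).dist a b * (((ℓ + 1) ^ k : ℕ) : ℝ) := by
  obtain ⟨p, hp⟩ := (connectedT (D := D) hMh hP).exists_walk_length_eq_dist a b
  have h := dist_posT_le_length D p
  rw [hp] at h
  exact h

end BondLength

/-! ## §3 `Ω = Ω_k ∩ Ω′_k`, the `L^k`-lattice points outside `Ω`, and `d(y, y′, Ω)` (3.154) -/

section TwoFamilies

variable {ℓ Mh k R : ℕ} {P : Fin (d + 1) → ℕ} (D D' : TDomains d ℓ Mh k P R)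

/-- **`Ω = Ω_k ∩ Ω′_k`** read on the sites of the torus: the sites at the top level `k` in BOTH families.
[cite: Balaban1985BackgroundPropagators, p.426 («we define Ω = Ω_k ∩ Ω′_k»)] -/
def OmegaSite : Finset ↥(boxDom (N0 ℓ Mh k P)) := univ.filter fun x => D.lev x.1 = k ∧ D'.lev x.1 = k

/-- the sites where the two level functions DIFFER (the support of the rows of `Δ′_a[D′] − Δ′_a[D]`, §4); a subset of `Ωᶜ`.
[cite: Balaban1985BackgroundPropagators, p.427 («at least one localization X_i intersects Ωᶜ»), dictionary] -/
def DiffSite : Finset ↥(boxDom (N0 ℓ Mh k P)) := univ.filter fun x => D.lev x.1 ≠ D'.lev x.1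

/-- `{lev_D ≠ lev_{D′}} ⊂ Ωᶜ`. [cite: Balaban1985BackgroundPropagators, p.427, dictionary] -/
theorem not_mem_OmegaSite_of_mem_DiffSite {x : ↥(boxDom (N0 ℓ Mh k P))} (hx : x ∈ DiffSite D D') :
    x ∉ OmegaSite D D' := by
  simp only [DiffSite, OmegaSite, mem_filter, mem_univ, true_and] at hx ⊢
  omega

/-- **`Ωᶜ ∩ T^{(k)}`**: the points of the `L^kη`-lattice (labels of `k`-blocks of the torus) whose `k`-block contains a site
outside `Ω`. [cite: Balaban1985BackgroundPropagators, (3.154) p.427 («y₁ ∈ Ωᶜ ∩ T^{(k)}»)] -/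
def OmegaC : Finset (Fin (d + 1) → ℤ) :=
  (univ.filter fun x : ↥(boxDom (N0 ℓ Mh k P)) => ¬ (D.lev x.1 = k ∧ D'.lev x.1 = k)).image
    fun x => blk ((ℓ + 1) ^ k) x.1

/-- a site outside `Ω` puts its `k`-lattice point into `Ωᶜ ∩ T^{(k)}`. [cite: Balaban1985BackgroundPropagators, (3.154) p.427, dictionary] -/
theorem blk_mem_OmegaC {x : ↥(boxDom (N0 ℓ Mh k P))} (hx : ¬ (D.lev x.1 = k ∧ D'.lev x.1 = k)) :
    blk ((ℓ + 1) ^ k) x.1 ∈ OmegaC D D' :=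
  mem_image_of_mem _ (mem_filter.2 ⟨mem_univ _, hx⟩)

/-- in particular a site where the level functions differ. [cite: Balaban1985BackgroundPropagators, (3.154) p.427, dictionary] -/
theorem blk_mem_OmegaC_of_lev_ne {x : ↥(boxDom (N0 ℓ Mh k P))} (hx : D.lev x.1 ≠ D'.lev x.1) :
    blk ((ℓ + 1) ^ k) x.1 ∈ OmegaC D D' :=
  blk_mem_OmegaC D D' fun h => hx (h.1.trans h.2.symm)

/-- **(2.1) ⇒ `Ω` IS A UNION OF `k`-BLOCKS**: a `k`-lattice point lies in `Ωᶜ ∩ T^{(k)}` iff the CORNER of its `k`-block is a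
site outside `Ω` (territories are unions of blocks of their own level, `TDomains.lev_eq_of_blk_eq`). [cite: Balaban1984PropagatorsII, (2.1) p.224 («Ω_j^{(j)} … is a sum of big blocks»); Balaban1985BackgroundPropagators, (3.154) p.427] -/
theorem mem_OmegaC_iff_exists {β : Fin (d + 1) → ℤ} :
    β ∈ OmegaC D D' ↔ ∃ x : ↥(boxDom (N0 ℓ Mh k P)), blk ((ℓ + 1) ^ k) x.1 = β ∧ ¬ (D.lev x.1 = k ∧ D'.lev x.1 = k) := by
  simp only [OmegaC, mem_image, mem_filter, mem_univ, true_and]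
  constructor
  · rintro ⟨x, hx, hβ⟩; exact ⟨x, hβ, hx⟩
  · rintro ⟨x, hβ, hx⟩; exact ⟨x, hx, hβ⟩

/-- level-`k` membership is constant on `k`-blocks (one family). [cite: Balaban1984PropagatorsII, (2.1)+(2.3) p.224] -/
theorem lev_eq_k_of_blk_eq {x x' : ↥(boxDom (N0 ℓ Mh k P))} (h : blk ((ℓ + 1) ^ k) x'.1 = blk ((ℓ + 1) ^ k) x.1)
    (hx : D.lev x.1 = k) : D.lev x'.1 = k := by
  have h' : blk ((ℓ + 1) ^ D.lev x.1) x'.1 = blk ((ℓ + 1) ^ D.lev x.1) x.1 := by rw [hx]; exact h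
  rw [D.lev_eq_of_blk_eq x.2 x'.2 h', hx]

/-- hence: `β ∈ Ωᶜ ∩ T^{(k)}` iff EVERY site of the `k`-block `β` is outside `Ω` (given one site of the block).
[cite: Balaban1984PropagatorsII, (2.1) p.224; Balaban1985BackgroundPropagators, (3.154) p.427] -/
theorem mem_OmegaC_iff_of_blk_eq {β : Fin (d + 1) → ℤ} {x₀ : ↥(boxDom (N0 ℓ Mh k P))} (h₀ : blk ((ℓ + 1) ^ k) x₀.1 = β) :
    β ∈ OmegaC D D' ↔ ¬ (D.lev x₀.1 = k ∧ D'.lev x₀.1 = k) := by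
  rw [mem_OmegaC_iff_exists]
  constructor
  · rintro ⟨x, hβ, hx⟩ ⟨h1, h2⟩
    have e : blk ((ℓ + 1) ^ k) x.1 = blk ((ℓ + 1) ^ k) x₀.1 := by rw [hβ, h₀]
    exact hx ⟨lev_eq_k_of_blk_eq D e h1, lev_eq_k_of_blk_eq D' e h2⟩
  · intro hx; exact ⟨x₀, h₀, hx⟩

/-- **`|y − y₁|` ON `T^{(k)}`**: the torus sup-distance of the centres of the `k`-blocks `β, β′` in units of `L^k` (the
`L^kη`-lattice has unit spacing after the rescaling `L^kη = 1`). [cite: Balaban1985BackgroundPropagators, (3.154) p.427, p.391 («η = L^{−k}»)] -/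
def tdistK (β β' : Fin (d + 1) → ℤ) : ℝ :=
  dist (toT (N0 ℓ Mh k P) (cenLab ((ℓ + 1) ^ k) β)) (toT (N0 ℓ Mh k P) (cenLab ((ℓ + 1) ^ k) β')) /
    (((ℓ + 1) ^ k : ℕ) : ℝ)

omit D D' in
/-- `|y − y₁| ≥ 0`. [cite: Balaban1985BackgroundPropagators, (3.154) p.427, dictionary] -/
theorem tdistK_nonneg (β β' : Fin (d + 1) → ℤ) : 0 ≤ tdistK (ℓ := ℓ) (Mh := Mh) (k := k) (P := P) β β' :=
  div_nonneg dist_nonneg (by positivity)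

/-- **(3.154) `d(y, y′, Ω) = inf_{y₁ ∈ Ωᶜ ∩ T^{(k)}} (|y − y₁| + |y₁ − y′|)`** for `k`-lattice points `y, y′` (labels of
`k`-blocks); by convention `0` when `Ωᶜ ∩ T^{(k)} = ∅`. [cite: Balaban1985BackgroundPropagators, (3.154) p.427] -/
def dOmega (β β' : Fin (d + 1) → ℤ) : ℝ :=
  if h : (OmegaC D D').Nonempty then
    (OmegaC D D').inf' h fun β₁ =>
      tdistK (ℓ := ℓ) (Mh := Mh) (k := k) (P := P) β β₁ + tdistK (ℓ := ℓ) (Mh := Mh) (k := k) (P := P) β₁ β'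
  else 0

/-- `d(y, y′, Ω) ≥ 0`. [cite: Balaban1985BackgroundPropagators, (3.154) p.427] -/
theorem dOmega_nonneg (β β' : Fin (d + 1) → ℤ) : 0 ≤ dOmega D D' β β' := by
  unfold dOmega
  split_ifs with h
  · exact (Finset.le_inf'_iff h _).2 fun β₁ _ => add_nonneg (tdistK_nonneg _ _) (tdistK_nonneg _ _)
  · exact le_rfl

/-- the infimum is below every competitor. [cite: Balaban1985BackgroundPropagators, (3.154) p.427] -/
theorem dOmega_le {β β' β₁ : Fin (d + 1) → ℤ} (h₁ : β₁ ∈ OmegaC D D') :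
    dOmega D D' β β' ≤ tdistK (ℓ := ℓ) (Mh := Mh) (k := k) (P := P) β β₁
      + tdistK (ℓ := ℓ) (Mh := Mh) (k := k) (P := P) β₁ β' := by
  unfold dOmega
  rw [dif_pos ⟨β₁, h₁⟩]
  exact Finset.inf'_le _ h₁

/-- the position of a TOP block of `𝔅` is the centre of its `k`-block. [cite: Balaban1984PropagatorsII, (2.45) p.231, dictionary] -/
theorem posT_eq_of_top {y : ↥(bset D.toDomains)} (hy : y.1.1 = k) :
    posT D y = toT (N0 ℓ Mh k P) (cenLab ((ℓ + 1) ^ k) y.1.2) := by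
  rw [posT, cen_eq_cenLab, hy]

/-- **THE METRIC STEP BEHIND «the exponential factor in (3.108) gives the factor (3.154)»** (at `U = 1`, one
intermediate localisation): for a top block `y` of `{Ω_j}`, a block `b` of `{Ω_j}` containing a site `z` where the two
level functions differ and a site `w`, and a top block `y′` of `{Ω′_j}`:
`d(y, y′, Ω) ≤ d_D(y, b) + d_{D′}(y^{D′}(w), y′) + 3` — `y₁ :=` the `k`-lattice point of `z` is in `Ωᶜ ∩ T^{(k)}`, and
`|y − y₁|`, `|y₁ − y′|` are measured along `y → b ∋ z, w → y^{D′}(w) → y′` by §2 and the block radii.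
[cite: Balaban1985BackgroundPropagators, Thm 3.14 (3.154) pp.426–427] -/
theorem dOmega_le_of_witness (hMh : 1 ≤ Mh) (hP : ∀ μ, 1 ≤ P μ) {y b : ↥(bset D.toDomains)} (hy : y.1.1 = k)
    {y' : ↥(bset D'.toDomains)} (hy' : y'.1.1 = k) {z w : ↥(boxDom (N0 ℓ Mh k P))} (hz : blkOf D.toDomains z = b)
    (hw : blkOf D.toDomains w = b) (hzlev : D.lev z.1 ≠ D'.lev z.1) :
    dOmega D D' y.1.2 y'.1.2 ≤ (geomT D).dist y b + (geomT D').dist (blkOf D'.toDomains w) y' + 3 := by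
  have hN : ∀ i, 1 ≤ N0 ℓ Mh k P i := one_le_N0 hMh hP
  set Lk : ℝ := (((ℓ + 1) ^ k : ℕ) : ℝ) with hLk
  have hLk1 : 1 ≤ Lk := by rw [hLk]; exact_mod_cast Nat.one_le_pow _ _ (by omega)
  have hLk0 : 0 < Lk := lt_of_lt_of_le one_pos hLk1
  -- the witness `y₁`
  have h₁ : blk ((ℓ + 1) ^ k) z.1 ∈ OmegaC D D' := blk_mem_OmegaC_of_lev_ne D D' hzlev
  refine (dOmega_le D D' h₁).trans ?_
  -- the points on the real torus (all in `TPt (N0 ℓ Mh k P)`)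
  have epy : toT (N0 ℓ Mh k P) (cenLab ((ℓ + 1) ^ k) y.1.2) = posT D y := (posT_eq_of_top D hy).symm
  have epy' : toT (N0 ℓ Mh k P) (cenLab ((ℓ + 1) ^ k) y'.1.2) = posT D' y' := (posT_eq_of_top D' hy').symm
  have epc : toT (N0 ℓ Mh k P) (cenLab ((ℓ + 1) ^ k) (blk ((ℓ + 1) ^ k) z.1))
      = toT (N0 ℓ Mh k P) (cenB ((ℓ + 1) ^ k) z.1) := rfl
  -- the block radii
  have hLb : (((ℓ + 1) ^ b.1.1 : ℕ) : ℝ) ≤ Lk := powL_mono_real (scale_bounds D.toDomains b).2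
  have hLb' : (((ℓ + 1) ^ (blkOf D'.toDomains w).1.1 : ℕ) : ℝ) ≤ Lk :=
    powL_mono_real (scale_bounds D'.toDomains (blkOf D'.toDomains w)).2
  have h_bz : dist (posT D b) (toT (N0 ℓ Mh k P) (toR z.1)) ≤ Lk / 2 := by
    have h := dist_site_posT_le (D := D) hz
    rw [dist_comm] at h
    linarith
  have h_zc : dist (toT (N0 ℓ Mh k P) (toR z.1)) (toT (N0 ℓ Mh k P) (cenB ((ℓ + 1) ^ k) z.1)) ≤ Lk / 2 := by
    have h := (dist_toT_le hN (toR z.1) (cenB ((ℓ + 1) ^ k) z.1)).trans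
      (dist_toR_cenB_le (Nat.one_le_pow _ _ (by omega)) z.1)
    refine h.trans ?_
    rw [hLk]; linarith
  have h_zw : dist (toT (N0 ℓ Mh k P) (toR z.1)) (toT (N0 ℓ Mh k P) (toR w.1)) ≤ Lk := by
    have h1 := dist_site_posT_le (D := D) hz
    have h2 := dist_site_posT_le (D := D) hw
    rw [dist_comm] at h2
    calc dist (toT (N0 ℓ Mh k P) (toR z.1)) (toT (N0 ℓ Mh k P) (toR w.1))
        ≤ dist (toT (N0 ℓ Mh k P) (toR z.1)) (posT D b) + dist (posT D b) (toT (N0 ℓ Mh k P) (toR w.1)) :=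
          dist_triangle _ _ _
      _ ≤ Lk := by linarith
  have h_wb' : dist (toT (N0 ℓ Mh k P) (toR w.1)) (posT D' (blkOf D'.toDomains w)) ≤ Lk / 2 :=
    (dist_site_posT_le (D := D') rfl).trans (by linarith)
  have h_yb : dist (posT D y) (posT D b) ≤ (geomT D).dist y b * Lk := dist_posT_le_mul_distT D hMh hP y b
  have h_b'y' : dist (posT D' (blkOf D'.toDomains w)) (posT D' y')
      ≤ (geomT D').dist (blkOf D'.toDomains w) y' * Lk := dist_posT_le_mul_distT D' hMh hP _ _
  -- the two legs `|y − y₁|` and `|y₁ − y′|`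
  have leg1 : dist (posT D y) (toT (N0 ℓ Mh k P) (cenB ((ℓ + 1) ^ k) z.1)) ≤ ((geomT D).dist y b + 1) * Lk := by
    calc dist (posT D y) (toT (N0 ℓ Mh k P) (cenB ((ℓ + 1) ^ k) z.1))
        ≤ dist (posT D y) (posT D b) + dist (posT D b) (toT (N0 ℓ Mh k P) (toR z.1))
            + dist (toT (N0 ℓ Mh k P) (toR z.1)) (toT (N0 ℓ Mh k P) (cenB ((ℓ + 1) ^ k) z.1)) :=
          dist_triangle4 _ _ _ _
      _ ≤ (geomT D).dist y b * Lk + Lk / 2 + Lk / 2 := by linarith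
      _ = ((geomT D).dist y b + 1) * Lk := by ring
  have leg2 : dist (toT (N0 ℓ Mh k P) (cenB ((ℓ + 1) ^ k) z.1)) (posT D' y')
      ≤ ((geomT D').dist (blkOf D'.toDomains w) y' + 2) * Lk := by
    have hcz : dist (toT (N0 ℓ Mh k P) (cenB ((ℓ + 1) ^ k) z.1)) (toT (N0 ℓ Mh k P) (toR z.1)) ≤ Lk / 2 := by
      rw [dist_comm]; exact h_zc
    calc dist (toT (N0 ℓ Mh k P) (cenB ((ℓ + 1) ^ k) z.1)) (posT D' y')
        ≤ dist (toT (N0 ℓ Mh k P) (cenB ((ℓ + 1) ^ k) z.1)) (toT (N0 ℓ Mh k P) (toR z.1))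
            + dist (toT (N0 ℓ Mh k P) (toR z.1)) (toT (N0 ℓ Mh k P) (toR w.1))
            + dist (toT (N0 ℓ Mh k P) (toR w.1)) (posT D' y') := dist_triangle4 _ _ _ _
      _ ≤ Lk / 2 + Lk + (dist (toT (N0 ℓ Mh k P) (toR w.1)) (posT D' (blkOf D'.toDomains w))
            + dist (posT D' (blkOf D'.toDomains w)) (posT D' y')) := by
          linarith [dist_triangle (toT (N0 ℓ Mh k P) (toR w.1)) (posT D' (blkOf D'.toDomains w)) (posT D' y')]
      _ ≤ Lk / 2 + Lk + (Lk / 2 + (geomT D').dist (blkOf D'.toDomains w) y' * Lk) := by linarith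
      _ = ((geomT D').dist (blkOf D'.toDomains w) y' + 2) * Lk := by ring
  -- in units of `L^k`
  unfold tdistK
  rw [epy, epy', epc, ← hLk, ← add_div, div_le_iff₀ hLk0]
  nlinarith [leg1, leg2]

end TwoFamilies

/-! ## §4 The perturbation `Δ′_a[D′] − Δ′_a[D]` and the resolvent identity -/

section Perturbation

variable {ℓ Mh k R : ℕ} {P : Fin (d + 1) → ℕ} (D D' : TDomains d ℓ Mh k P R) (a : ℕ → ℝ)

/-- **THE PERTURBATION `Δ′_a[Ω′] − Δ′_a[Ω]`** of the genuine `k`-level operators (2.13)–(2.14) of the two families on the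
torus. [cite: Balaban1984PropagatorsII, (2.13)–(2.14) p.225; Balaban1985BackgroundPropagators, Thm 3.14 p.427] -/
def diffM : Matrix ↥(boxDom (N0 ℓ Mh k P)) ↥(boxDom (N0 ℓ Mh k P)) ℝ :=
  mlOpT (N0 ℓ Mh k P) ℓ k D'.lev a - mlOpT (N0 ℓ Mh k P) ℓ k D.lev a

/-- **ENTRIES OF THE PERTURBATION**: the periodic Laplacians cancel; what remains are the averaging terms of (2.14) for the two
level functions, `levC_{lev′x}[x′ ∼_{lev′x} x] − levC_{lev x}[x′ ∼_{lev x} x]`. [cite: Balaban1984PropagatorsII, (2.13)–(2.14) p.225] -/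
theorem diffM_apply (x y : ↥(boxDom (N0 ℓ Mh k P))) :
    diffM D D' a x y
      = avgK (levC d ℓ a (D'.lev x.1)) ((ℓ + 1) ^ D'.lev x.1) x.1 y.1
        - avgK (levC d ℓ a (D.lev x.1)) ((ℓ + 1) ^ D.lev x.1) x.1 y.1 := by
  unfold diffM
  rw [Matrix.sub_apply, mlOpT_apply D' rfl a x y, mlOpT_apply D rfl a x y]
  ring

/-- **THE ROWS OF THE PERTURBATION VANISH WHERE THE LEVEL FUNCTIONS AGREE** — in particular on `Ω = Ω_k ∩ Ω′_k` (print: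
«in the difference all terms for walks with localizations contained in Ω are cancelled»). [cite: Balaban1985BackgroundPropagators, Thm 3.14 p.427] -/
theorem diffM_apply_of_lev_eq {x : ↥(boxDom (N0 ℓ Mh k P))} (hx : D.lev x.1 = D'.lev x.1)
    (y : ↥(boxDom (N0 ℓ Mh k P))) : diffM D D' a x y = 0 := by
  rw [diffM_apply, hx, sub_self]

/-- the perturbation vanishes identically when the level functions coincide. [cite: Balaban1985BackgroundPropagators, Thm 3.14 p.427, dictionary] -/
theorem diffM_eq_zero_of_lev_eq (h : ∀ x : ↥(boxDom (N0 ℓ Mh k P)), D.lev x.1 = D'.lev x.1) : diffM D D' a = 0 := by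
  ext x y; rw [diffM_apply_of_lev_eq D D' a (h x)]; rfl

/-- the averaging kernel of level `lev x` at `x` is the indicator of the block `y^{lev x}(x)` of `𝔅`:
`levC·[y ∈ B(x)]`. [cite: Balaban1984PropagatorsII, (2.14) p.225, dictionary] -/
theorem avgK_lev_eq (D₀ : TDomains d ℓ Mh k P R) (c : ℝ) (x y : ↥(boxDom (N0 ℓ Mh k P))) :
    avgK c ((ℓ + 1) ^ D₀.lev x.1) x.1 y.1 = if blkOf D₀.toDomains y = blkOf D₀.toDomains x then c else 0 := by
  unfold avgK
  have e : (blk ((ℓ + 1) ^ D₀.lev x.1) y.1 = blk ((ℓ + 1) ^ D₀.lev x.1) x.1)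
      ↔ blkOf D₀.toDomains y = blkOf D₀.toDomains x := by
    rw [blkOf_eq_iff_blk D₀.toDomains]; rfl
  by_cases h : blk ((ℓ + 1) ^ D₀.lev x.1) y.1 = blk ((ℓ + 1) ^ D₀.lev x.1) x.1
  · rw [if_pos h, if_pos (e.1 h)]
  · rw [if_neg h, if_neg (fun h' => h (e.2 h'))]

/-- one averaging term applied to a vector: `levC_j·Σ_{y ∈ B(x)} v(y)` is bounded by `a_j·L^{−2j}·max_{B(x)}|v|` (the block
has at most `L^{j(d+1)}` sites, `B6Ineq268MultiLevelBox.card_blkOf_le`). [cite: Balaban1984PropagatorsII, (2.14) p.225, dictionary] -/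
theorem abs_sum_avgK_mul_le (D₀ : TDomains d ℓ Mh k P R) (ha : ∀ j, 0 ≤ a j) (v : ↥(boxDom (N0 ℓ Mh k P)) → ℝ)
    (x : ↥(boxDom (N0 ℓ Mh k P))) {F : ℝ} (hF : ∀ y, blkOf D₀.toDomains y = blkOf D₀.toDomains x → |v y| ≤ F) :
    |∑ y, avgK (levC d ℓ a (D₀.lev x.1)) ((ℓ + 1) ^ D₀.lev x.1) x.1 y.1 * v y|
      ≤ a (D₀.lev x.1) * ((((ℓ : ℝ) + 1) ^ D₀.lev x.1) ^ 2)⁻¹ * F := by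
  classical
  set s := blkOf D₀.toDomains x with hs
  have hF0 : 0 ≤ F := le_trans (abs_nonneg _) (hF x rfl)
  have hc0 : 0 ≤ levC d ℓ a (D₀.lev x.1) := by
    unfold levC; have := ha (D₀.lev x.1); positivity
  -- the kernel is `levC` times the indicator of the block of `x`
  have hsum : ∑ y, avgK (levC d ℓ a (D₀.lev x.1)) ((ℓ + 1) ^ D₀.lev x.1) x.1 y.1 * v y
      = levC d ℓ a (D₀.lev x.1) * ∑ y ∈ univ.filter (fun y => blkOf D₀.toDomains y = s), v y := by
    rw [Finset.mul_sum, Finset.sum_filter]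
    refine Finset.sum_congr rfl fun y _ => ?_
    rw [avgK_lev_eq D₀]
    split_ifs <;> simp
  rw [hsum, abs_mul, abs_of_nonneg hc0]
  -- at most `#B(x) ≤ W` terms of size `≤ F`
  have hbnd : |∑ y ∈ univ.filter (fun y => blkOf D₀.toDomains y = s), v y|
      ≤ (((univ.filter fun y => blkOf D₀.toDomains y = s).card : ℕ) : ℝ) * F := by
    refine (Finset.abs_sum_le_sum_abs _ _).trans ?_
    have h : ∑ y ∈ univ.filter (fun y => blkOf D₀.toDomains y = s), |v y|
        ≤ ∑ _y ∈ univ.filter (fun y => blkOf D₀.toDomains y = s), F :=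
      Finset.sum_le_sum fun y hy => hF y (mem_filter.1 hy).2
    rwa [Finset.sum_const, nsmul_eq_mul] at h
  have hcard : (((univ.filter fun y => blkOf D₀.toDomains y = s).card : ℕ) : ℝ) ≤ W D₀.toDomains s :=
    card_blkOf_le D₀.toDomains s
  have hW : W D₀.toDomains s = (((ℓ : ℝ) + 1) ^ D₀.lev x.1) ^ (d + 1) := by rw [W_eq]; rfl
  have hL0 : (0 : ℝ) < (((ℓ : ℝ) + 1) ^ D₀.lev x.1) ^ (d + 1) := by positivity
  calc levC d ℓ a (D₀.lev x.1) * |∑ y ∈ univ.filter (fun y => blkOf D₀.toDomains y = s), v y|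
      ≤ levC d ℓ a (D₀.lev x.1) * ((((univ.filter fun y => blkOf D₀.toDomains y = s).card : ℕ) : ℝ) * F) :=
        mul_le_mul_of_nonneg_left hbnd hc0
    _ ≤ levC d ℓ a (D₀.lev x.1) * (W D₀.toDomains s * F) :=
        mul_le_mul_of_nonneg_left (mul_le_mul_of_nonneg_right hcard hF0) hc0
    _ = a (D₀.lev x.1) * ((((ℓ : ℝ) + 1) ^ D₀.lev x.1) ^ 2)⁻¹ * F := by
        rw [hW]; unfold levC; field_simp

/-- **THE ROW BOUND OF THE PERTURBATION**: for `z` with `lev z ≠ lev′ z`,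
`|(diffM·v)(z)| ≤ a_{lev′z}L^{−2lev′z}·F′ + a_{lev z}L^{−2lev z}·F` whenever `|v| ≤ F′` on the `D′`-block of `z` and
`|v| ≤ F` on the `D`-block of `z`; the row is `0` when `lev z = lev′ z`. [cite: Balaban1984PropagatorsII, (2.14) p.225; Balaban1985BackgroundPropagators, Thm 3.14 p.427] -/
theorem abs_diffM_mulVec_le (ha : ∀ j, 0 ≤ a j) (v : ↥(boxDom (N0 ℓ Mh k P)) → ℝ) (z : ↥(boxDom (N0 ℓ Mh k P)))
    {F F' : ℝ} (hF : ∀ y, blkOf D.toDomains y = blkOf D.toDomains z → |v y| ≤ F)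
    (hF' : ∀ y, blkOf D'.toDomains y = blkOf D'.toDomains z → |v y| ≤ F') :
    |(diffM D D' a *ᵥ v) z|
      ≤ a (D'.lev z.1) * ((((ℓ : ℝ) + 1) ^ D'.lev z.1) ^ 2)⁻¹ * F'
        + a (D.lev z.1) * ((((ℓ : ℝ) + 1) ^ D.lev z.1) ^ 2)⁻¹ * F := by
  have h : (diffM D D' a *ᵥ v) z
      = (∑ y, avgK (levC d ℓ a (D'.lev z.1)) ((ℓ + 1) ^ D'.lev z.1) z.1 y.1 * v y)
        - ∑ y, avgK (levC d ℓ a (D.lev z.1)) ((ℓ + 1) ^ D.lev z.1) z.1 y.1 * v y := by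
    simp only [Matrix.mulVec, dotProduct, diffM_apply, sub_mul, Finset.sum_sub_distrib]
  rw [h]
  exact (abs_sub _ _).trans (add_le_add (abs_sum_avgK_mul_le a D' ha v z hF') (abs_sum_avgK_mul_le a D ha v z hF))

/-- `Δ′_a·G′ = 1` on the torus with positivity of the weights at levels `≥ 1` only (twin of
`B6Prop22MultiLevelTorus.gmlT_mul_mlOpT_pos`). [cite: Balaban1984PropagatorsII, p.225 («G′ = Δ′_a^{−1} is a well defined … operator»)] -/
theorem mlOpT_mul_gmlT_pos {N : Fin (d + 1) → ℕ} {lev : (Fin (d + 1) → ℤ) → ℕ} (hN : ∀ i, 1 ≤ N i)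
    (hlev1 : ∀ x, 1 ≤ lev x) (hlevk : ∀ x, lev x ≤ k) {a : ℕ → ℝ} (ha : ∀ j, 1 ≤ j → 0 < a j) :
    mlOpT N ℓ k lev a * gmlT N ℓ k lev a = 1 := by
  have h := B6Prop22MultiLevelTorus.mlOpT_congr_weights (N := N) (ℓ := ℓ) (k := k) hlev1 (a := a)
    (a' := fun j => if j = 0 then 1 else a j) (fun j hj => by rw [if_neg (by omega)])
  have hpos : ∀ j, 0 < (fun j => if j = 0 then (1 : ℝ) else a j) j := fun j => by
    dsimp only
    split_ifs with h0
    · exact one_pos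
    · exact ha j (Nat.pos_of_ne_zero h0)
  unfold gmlT
  rw [h]
  exact mlOpT_mul_gmlT hN hlevk hpos

/-- **THE RESOLVENT IDENTITY** `G′[Ω] − G′[Ω′] = G′[Ω]·(Δ′_a[Ω′] − Δ′_a[Ω])·G′[Ω′]` for the genuine `k`-level torus
operators of the two families (the algebraic form, at `U = 1`, of «we take random walk expansions for both operators, and in
the difference all terms for walks with localizations contained in Ω are cancelled»). [cite: Balaban1985BackgroundPropagators, Thm 3.14 p.427; Balaban1984PropagatorsII, p.225] -/
theorem gmlT_sub_gmlT (hMh : 1 ≤ Mh) (hP : ∀ μ, 1 ≤ P μ) (ha : ∀ j, 1 ≤ j → 0 < a j) :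
    gmlT (N0 ℓ Mh k P) ℓ k D.lev a - gmlT (N0 ℓ Mh k P) ℓ k D'.lev a
      = gmlT (N0 ℓ Mh k P) ℓ k D.lev a * diffM D D' a * gmlT (N0 ℓ Mh k P) ℓ k D'.lev a := by
  have hN := one_le_N0 hMh hP (ℓ := ℓ) (k := k)
  have h1 : gmlT (N0 ℓ Mh k P) ℓ k D.lev a * mlOpT (N0 ℓ Mh k P) ℓ k D.lev a = 1 :=
    B6Prop22MultiLevelTorus.gmlT_mul_mlOpT_pos hN D.one_le_lev D.lev_le ha
  have h2 : mlOpT (N0 ℓ Mh k P) ℓ k D'.lev a * gmlT (N0 ℓ Mh k P) ℓ k D'.lev a = 1 :=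
    mlOpT_mul_gmlT_pos hN D'.one_le_lev D'.lev_le ha
  unfold diffM
  rw [Matrix.mul_sub, Matrix.sub_mul, Matrix.mul_assoc _ (mlOpT _ _ _ D'.lev a), h2, Matrix.mul_one, h1,
    Matrix.one_mul]

/-- … as linear maps. [cite: Balaban1985BackgroundPropagators, Thm 3.14 p.427] -/
theorem toLin_gmlT_sub (hMh : 1 ≤ Mh) (hP : ∀ μ, 1 ≤ P μ) (ha : ∀ j, 1 ≤ j → 0 < a j) :
    Matrix.toLin' (gmlT (N0 ℓ Mh k P) ℓ k D.lev a) - Matrix.toLin' (gmlT (N0 ℓ Mh k P) ℓ k D'.lev a)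
      = Matrix.toLin' (gmlT (N0 ℓ Mh k P) ℓ k D.lev a) * Matrix.toLin' (diffM D D' a)
          * Matrix.toLin' (gmlT (N0 ℓ Mh k P) ℓ k D'.lev a) := by
  rw [← map_sub, gmlT_sub_gmlT D D' a hMh hP ha, Module.End.mul_eq_comp, Module.End.mul_eq_comp,
    ← Matrix.toLin'_mul, ← Matrix.toLin'_mul]

/-- the two operators COINCIDE when the level functions do (`Ωᶜ ∩ {lev ≠ lev′} = ∅`). [cite: Balaban1985BackgroundPropagators, Thm 3.14 p.427, dictionary] -/
theorem gmlT_eq_of_lev_eq (hMh : 1 ≤ Mh) (hP : ∀ μ, 1 ≤ P μ) (ha : ∀ j, 1 ≤ j → 0 < a j)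
    (h : ∀ x : ↥(boxDom (N0 ℓ Mh k P)), D.lev x.1 = D'.lev x.1) :
    gmlT (N0 ℓ Mh k P) ℓ k D.lev a = gmlT (N0 ℓ Mh k P) ℓ k D'.lev a := by
  have e := gmlT_sub_gmlT D D' a hMh hP ha
  rw [diffM_eq_zero_of_lev_eq D D' a h, Matrix.mul_zero, Matrix.zero_mul] at e
  exact sub_eq_zero.1 e

end Perturbation

end

end Literature.MathematicalPhysics.QuantumFieldTheory.Balaban1983to89.B9Thm314GpFlatTorusGeometry
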